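import Summits.CriticalPhenomena.PercolationContinuityZ3.Theorems.Transplant.SkelPhiRootSchedClauses
import HarnessLib

/-!
# D″ node, (R) layer — SCHEDULE-GENERIC form, part 3: THE ROOT RESIDUE OF THE TWO-UNIT CONCENTRIC SCHEME OF RECORD FROM ANY ROOT
# SCHEDULES — `Skelφ.rootOblS_concSG_sched` / **`Skelφ.rootOblT_concSG_sched`**: `Skel.RootOblT G ⟨Skelφ.cellGeomSG G φ P w₀ Λ, q, δc⟩ Δ' δr` from
# per-direction planar schedules `Sc du : ChainPlanar.Schedule` owing FIVE planar facts (regions in `BtwN 0 du ∪ Q (0+du)`, off `Q 0`, last core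
# in `M (0+du)`, start core holding the landing ROW `{level = ca, |trans| ≤ q'}` about `rootCtr du ca 0`, `Rlev + 1 ≤ R'`), their kit clauses
# (`hkits_sched`) and first hop (`root_hsrc_row`) from ONE Step-I′ certificate at the running density, their rim excess (`real_rim_le_schedSG`)
# from an excess radius — so that the root schedule of record (`RootRun2.rootSched` over `BandOK`, its `BandOKR` twin without the idle `hρ0`,
# or an appended short-prefix schedule) is chosen by the params layer WITHOUT re-typing (R); successor of `SkelPhiRootAssembly` (rootSched-specific)

builds on p205010 (kernel theorem, internal audit signed; external expert review pending) — nothing in this file uses p205010.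
Status sentence (coordinator 2026-08-20T04:30Z): "θ(p_c) = 0 on ℤ^d, all d ≥ 2 — kernel-verified (Lean 4/Mathlib, standard axioms); internal
adversarial audit SIGNED 2026-08-20 04:29Z; external expert review pending."
Lane `prim-bschramm-*`, seat `prim-bschramm-p2` (gen 8; (R) = p2 lineage under D″); helper file (`--supports stmt-CriticalPhenomena-4575`).

THE BINDER LIST = that of `SkelPhiRootAssembly.rootOblT_concSG_raw` with the rooted band run REPLACED by the five planar facts of `Sc du` and the
route hypotheses stated per step `k ≤ (Sc du).N` along the step's own axis `(Sc du).ax k` with the schedule's own extents `[(Sc du).ℓ₀, (Sc du).ℓ₁]`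
and spreads `(Sc du).Wb k` (see `hkits_sched`); the first hop needs `ca ≤ 25 r∥`, `q' ≤ 5 r⊥ − 1` explicitly (no `RootBandOK` to read them from).
* **`Skelφ.rootOblS_concSG_sched`**, **`Skelφ.rootOblT_concSG_sched`**.
[cite: KozmaNitzan2024, §4 p. 28 ((32) at the root), Lemma 9 (p. 16), Lemma 10 (pp. 17–22), Lemma 11 (pp. 22–23), Lemma 12 (p. 24)]
-/

noncomputable section

open MeasureTheory ProbabilityTheory
open scoped ENNReal Classical

namespace Summit.CriticalPhenomena.PercolationContinuityZ3.Theorems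

namespace Transplant

namespace Skelφ

open Literature.Probability.Percolation Literature.Probability.LatticeModels SimpleGraph GadgetSystem ProbeHistory HSiteScheme Contour KNCells
open Literature.Probability.Percolation.KozmaNitzan
open Literature.Probability.Percolation.KozmaNitzan.Cells (oth oth_ne eq_oth_of_ne sgOf sgOf_sign)
open KNCells.KSchA KNLevels ChainPlanar
open Literature.Barriers.CriticalPhenomena (graphBall mem_graphBall_self graphBall_mono)
open BoxProdZ2 (ConcRadiiG rootCtr)
open Skel (winGraph excess RootOblT)
open SkelI (tanOff)
open RootRun2 (natAbs_add_le_of_mem_root_region₂)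

variable {V : Type} [DecidableEq V] [Countable V] {G : SimpleGraph V} [G.LocallyFinite] {φ : V → Site 2} {types : Finset V}

/-- **THE ROOT RESIDUE OF THE TWO-UNIT CONCENTRIC SCHEME OF RECORD FROM ANY ROOT SCHEDULES** (design D″, (R), schedule-generic):
`Skelφ.RootOblS` for `⟨Skelφ.cellGeomSG G φ P w₀ Λ, q, δc⟩` from per-direction schedules `Sc du` with their five planar facts, ONE Step-I′
certificate at the running density (kit clauses and first hop), an excess radius at the running density (rim excess), the counts and the
radius facts. [cite: KozmaNitzan2024, §4 p. 28 ((32) at the root), Lemma 9 (p. 16), Lemma 10 (pp. 17–22), Lemma 11 (pp. 22–23), Lemma 12 (p. 24)] -/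
theorem rootOblS_concSG_sched (hlip : Lip G φ) (hstep : Steps G φ) (hfr : Frames G φ types) (hκ : CylConn G φ types) {Δ : ℕ}
    (hΔ : ∀ v, G.degree v ≤ Δ) {p : unitInterval} (hC : CylSubcritical G φ types p) (P : PCells2) (w₀ : V) {Λ : ConcRadiiG}
    (hΛ : WFS2 P Λ) (hφ : φ w₀ = 0) (q : unitInterval) (δc : ℝ) {Δ' : ℕ} {δr : ℕ → ℝ} {Rt L' E₀ : ℕ}
    -- the root schedules, per direction, with their planar facts and level windows
    (Sc : MDir → Schedule) {Rlev Nc j₀ j₁ : MDir → ℕ} {ca q' : MDir → ℤ}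
    (hreg : ∀ du, ∀ k ≤ (Sc du).N, (Sc du).region k ⊆ P.BtwN 0 du ∪ P.Q ((0 : Site 2) + stepVec du))
    (hQ0 : ∀ du, ∀ k ≤ (Sc du).N, Disjoint ((Sc du).region k) (P.Q 0))
    (hlast : ∀ du, (Sc du).core ((Sc du).N + 1) ⊆ P.M ((0 : Site 2) + stepVec du))
    (hrow : ∀ du : MDir, sBox du.1 (sgOf du) (rootCtr du (ca du) 0) (-0) 0 (q' du) ⊆ (Sc du).core 0)
    (hca25 : ∀ du : MDir, ca du ≤ 25 * (P.r du.1 : ℤ)) (hq'5 : ∀ du : MDir, q' du ≤ 5 * (P.r (oth du.1) : ℤ) - 1)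
    (hRl : ∀ du, Rlev du + 1 ≤ (Sc du).R') (hj : ∀ du, j₁ du ≤ Rlev du)
    -- radius facts (uniform window depth `Rt`), the depth of the wired root cube
    (hRB : ∀ du, Rt + 1 ≤ Λ.rB 0 0 du) (hRQ : ∀ du, Rt + 1 ≤ Λ.rQ 0 ((0 : Site 2) + stepVec du))
    (hRM : ∀ du, Rt + 1 ≤ Λ.rM 0 ((0 : Site 2) + stepVec du)) (hRt : 60 * P.rmax ≤ Rt) (hQE : Λ.rQ 0 0 ≤ E₀)
    -- accuracy and the count
    (hδr0 : ∀ du, 0 < δr (Sc du).N) (hδr1 : ∀ du, δr (Sc du).N ≤ 1)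
    (hcount : ∀ du, 1 / (1 - (q : ℝ)) ^ (Δ' * Nc du) ≤ δr (Sc du).N * ((Finset.Icc (j₀ du) (j₁ du)).card : ℝ))
    -- ONE Step-I′ certificate at the running density `q`, threshold `1 − δI`, `δI ≤ (δr N)²`
    {D : StepI.Data V} {off : ℕ} (hD : D.Λ = fatSeqOff hfr hC off) {Sz Sx Sy : Finset ℕ} {δI : ℝ}
    (hin : ∀ i ∈ StepI.index types Sz Sx Sy, 1 - δI < (bondPercolation G q).real (StepI.event G φ D i))
    (hδI : ∀ du, δI ≤ δr (Sc du).N ^ 2)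
    -- the kit: zone scale, certified extents, half-widths, radii
    {Mz : ℕ} (hMz : Mz ∈ Sz) (hkz : D.k ≤ Mz) {ℓK : Fin 2 → ℕ} (hℓK0 : ∀ I, I = 0 → ℓK I ∈ Sx) (hℓK1 : ∀ I, I = 1 → ℓK I ∈ Sy)
    {A : Fin 2 → Fin 2 → ℕ} {Rk : Fin 2 → ℕ} (hAw : ∀ I, A I = StepI.widths D.Gb D.Fb I (ℓK I)) (hRk : ∀ I, Rk I = D.R (amax (A I)))
    -- p1-g9's kit / slab / shell constants, the level windows above `T₀`, the near threshold inside the rim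
    {ℓs M K Rsd r₀ rs cU : ℕ} (hℓs : 1 ≤ ℓs) (hj₀ : ∀ du, tanOff ℓs M ≤ j₀ du)
    (hA : ∀ i k, A i k ≤ M) (hAℓ : ∀ i, A i (oth i) ≤ ℓs) (hK : ∀ i, ℓs + 1 + A i i + Rk i ≤ K)
    (hnA : ∀ i, Mz + 1 ≤ A i i) (hnM : Mz ≤ M) (hρK : ∀ i, ℓs + 1 + A i i + (fatRadius hfr hC Mz + off) ≤ K)
    (hR'₁ : cylRadMax G φ types ℓs (ℓs + 2 + 2 * tanOff ℓs M) ≤ Rsd) (hR'₂ : ∀ i, cylRadMax G φ types ℓs (ℓs + 2 + A i i + Rk i) ≤ Rsd)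
    (hr₀₁ : ℓs + 1 + tanOff ℓs M + Rsd ≤ r₀) (hr₀₂ : ℓs + 2 + tanOff ℓs M + K ≤ r₀) (hr₀L : r₀ ≤ L') (hLR : L' ≤ Rt)
    (hrs₁ : ℓs + 2 + tanOff ℓs M + Rsd ≤ rs) (hrs₂ : ℓs + 2 + tanOff ℓs M + K ≤ rs) (hcU : ∀ i, (Δ + 1) ^ Rk i ≤ cU)
    -- the routes: certified extents beyond the zone scale along each step's axis, depth, band spreads
    (hMℓ : ∀ du, Mz + 1 ≤ (Sc du).ℓ₀)
    (hSx : ∀ du, ∀ k ≤ (Sc du).N, (Sc du).ax k = 0 → ∀ ℓ, (Sc du).ℓ₀ ≤ ℓ → ℓ ≤ (Sc du).ℓ₁ → ℓ ∈ Sx)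
    (hSy : ∀ du, ∀ k ≤ (Sc du).N, (Sc du).ax k = 1 → ∀ ℓ, (Sc du).ℓ₀ ≤ ℓ → ℓ ≤ (Sc du).ℓ₁ → ℓ ∈ Sy)
    (hdepth : ∀ du, ∀ k ≤ (Sc du).N, ∀ I ℓ, (Sc du).ℓ₀ ≤ ℓ → ℓ ≤ (Sc du).ℓ₁ →
      2 * ℓs + 2 + tanOff ℓs M + A I I + D.R (amax (StepI.widths D.Gb D.Fb ((Sc du).ax k) ℓ)) ≤ r₀)
    (hWb : ∀ du, ∀ k ≤ (Sc du).N, ∀ ℓ, (Sc du).ℓ₀ ≤ ℓ → ℓ ≤ (Sc du).ℓ₁ →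
      StepI.widths D.Gb D.Fb ((Sc du).ax k) ℓ (oth ((Sc du).ax k)) ≤ (Sc du).Wb k ℓ)
    -- the kit counts
    (kk : MDir → ℕ) (hN : ∀ du, kk du * (Δ + 1) ^ (2 * rs) ≤ Nc du)
    (hk : ∀ du, (1 - (q : ℝ) ^ (1 + Δ * ((Δ + 1) ^ Rsd + (tanOff ℓs M + 2)) + ((Δ + 1) ^ Rsd + (tanOff ℓs M + 2)) * cU)) ^ kk du ≤
      δr (Sc du).N)
    -- the rim excess: an excess radius at the running density
    {mex R₁ : ℕ} {η : ℝ} (hη : ∀ du, η ≤ δr (Sc du).N / 2) (hmex : 60 * P.rmax ≤ mex)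
    (hR₁ : ∀ R'', R₁ ≤ R'' → ∀ (Rw : ℕ) (D' A' : Finset V), (∀ d ∈ D', d ∈ graphBall G w₀ Rw) →
      (∀ d ∈ D', ∀ d' ∈ D', φ d - φ d' ∈ box 2 mex) → A' ⊆ D' → (∀ a ∈ A', a ∈ graphBall G w₀ (E₀ + 1)) →
        (bondPercolation G q).real (excess G w₀ R'' D' A') ≤ η)
    (hR : R₁ ≤ Rt - L')
    -- the first hop: extent `ℓ1` along `du.1`, its planar placement and depths
    {ℓ1 : MDir → ℕ} (hℓ1x : ∀ du : MDir, du.1 = 0 → ℓ1 du ∈ Sx) (hℓ1y : ∀ du : MDir, du.1 = 1 → ℓ1 du ∈ Sy)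
    (hℓ1ca : ∀ du, (ℓ1 du : ℤ) ≤ ca du) (hℓ1Q : ∀ du : MDir, (ℓ1 du : ℤ) ≤ 5 * (P.r du.1 : ℤ))
    (hcaQ : ∀ du : MDir, ca du - ℓ1 du + D.k ≤ 5 * (P.r du.1 : ℤ)) (hkQ : ∀ du : MDir, (D.k : ℤ) ≤ 5 * (P.r (oth du.1) : ℤ))
    (hW₁ : ∀ du : MDir, (StepI.widths D.Gb D.Fb du.1 (ℓ1 du) (oth du.1) : ℤ) ≤ q' du)
    {R₀ Rp : ℕ} (hR₀ : ∀ du : MDir, 5 * P.r du.1 + (fatRadius hfr hC D.k + off) ≤ R₀) (hR₀Q : R₀ + 1 ≤ Λ.rQ 0 0) (hR₀t : R₀ ≤ Rt)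
    (hRp : ∀ du : MDir, 5 * P.r du.1 + D.R (amax (StepI.widths D.Gb D.Fb du.1 (ℓ1 du))) ≤ Rp) (hRpQ : Rp + 1 ≤ Λ.rQ 0 0)
    (hRpB : ∀ du, Rp + 1 ≤ Λ.rB 0 0 du) (hRpQ' : ∀ du, Rp + 1 ≤ Λ.rQ 0 ((0 : Site 2) + stepVec du)) (hRpt : Rp ≤ Rt) :
    RootOblS G (⟨cellGeomSG G φ P w₀ Λ, q, δc⟩ : KSchA V ℕ) Δ' δr := by
  set U : MDir → Finset V := fun du => rootUS G φ P w₀ Λ q δc Rt du with hUdef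
  set Pc : MDir → WinChainData V := fun du => rootWCD G φ w₀ Rt L' (Sc du) (Rlev du) (Nc du) (j₀ du) (j₁ du) (U du) with hPcdef
  -- the certificate at the per-direction thresholds `1 − (δr N)²` and `1 − δr N`
  have hsq : ∀ du, δr (Sc du).N ^ 2 ≤ δr (Sc du).N := fun du => by nlinarith [hδr0 du, hδr1 du]
  have hin' : ∀ du, ∀ i ∈ StepI.index types Sz Sx Sy, 1 - δr (Sc du).N ^ 2 < (bondPercolation G q).real (StepI.event G φ D i) :=
    fun du i hi => lt_of_le_of_lt (by linarith [hδI du]) (hin i hi)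
  -- the first hop onto the landing row, per direction
  have hhop : ∀ du : MDir, ∃ B₀ : Finset V, B₀ ⊆ Win G φ w₀ (sBox du.1 (sgOf du) (rootCtr du (ca du) 0) (-0) 0 (q' du)) Rt ∧
      1 - δI < (prodBernoulli ((⟨cellGeomSG G φ P w₀ Λ, q, δc⟩ : KSchA V ℕ).W0sub G (U du))).real (⋃ t ∈ B₀, openConn w₀ t) :=
    fun du => root_hsrc_row hstep hfr hC hφ (hca25 du) (hq'5 du) hD hin (hℓ1x du) (hℓ1y du) (hℓ1ca du) (hℓ1Q du) (hcaQ du) (hkQ du)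
      (hW₁ du) (hR₀ du) hR₀Q hR₀t (hRp du) hRpQ (hRpB du) (hRpQ' du) hRpt
  choose B₀ hB₀ hsrc using hhop
  refine rootOblS_concSG hlip hstep P w₀ hΛ hφ q δc (fun _ => Rt) Sc Pc B₀ (fun _ => η) (fun _ => rfl) (fun _ => rfl) hRl
    (fun du k => rootWCD_Rim_subset hlip ..) hj (fun du k hk => ?_) hRB hRQ hRM hreg hQ0 hlast hcount (fun du k hkN j hjj => ?_) hη
    (fun du k hkN => ?_) (fun du => ?_) (fun du => ?_)
  · -- the true targets are nonempty: a core point lies under a vertex of depth `≤ 60 rmax ≤ Rt` (`Steps`)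
    obtain ⟨x, hx⟩ := (Sc du).core_nonempty (k := k + 1) (by omega)
    have hxr : x ∈ P.BtwN 0 du ∪ P.Q ((0 : Site 2) + stepVec du) := (Sc du).core_subset_of_region_subset (hreg du) (by omega) hx
    obtain ⟨g, hg, hφg⟩ := exists_mem_graphBall_φ_eq hstep w₀ x
    simp only [hφ, Pi.zero_apply, sub_zero] at hg
    refine ⟨g, ?_⟩
    rw [PlanarWindow.coreT, planarWindowWin_W, mem_Win]
    exact ⟨graphBall_mono G w₀ ((natAbs_add_le_of_mem_root_region₂ P du hxr).trans hRt) hg, by rw [hφg]; exact hx⟩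
  · -- the kit clauses (schedule-generic)
    exact hkits_sched hlip hstep hfr hκ hΔ hC (hreg du) (hQ0 du) (hRB du) (hRQ du) (hRl du) (hj du) hD (hδr0 du) (hin' du) hMz hkz hℓK0
      hℓK1 hAw hRk hℓs (hj₀ du) hA hAℓ hK hnA hnM hρK hR'₁ hR'₂ hr₀₁ hr₀₂ hr₀L hLR hrs₁ hrs₂ hcU (hMℓ du) (hSx du) (hSy du) (hdepth du)
      (hWb du) (kk du) (hN du) (hk du) (Pc du) rfl hkN hjj
  · -- the rim excess (schedule-generic)
    exact real_rim_le_schedSG hlip hstep hΛ hφ (hreg du) (hQ0 du) (hRB du) (hRQ du) hQE hmex hR₁ hR hkN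
  · -- the first-hop set lies in the first level (the landing row inside core 0)
    rw [WinChainData.stepL_X_zero, planarWindowWin_W]
    exact (hB₀ du).trans (Win_mono G φ (hrow du) le_rfl)
  · -- the first hop at accuracy `δr N` (`δI ≤ (δr N)² ≤ δr N`)
    exact lt_of_le_of_lt (by linarith [hδI du, hsq du]) (hsrc du)

/-- **THE NODE-FACING ROOT RESIDUE `Skel.RootOblT` OF THE TWO-UNIT SCHEME OF RECORD FROM ANY ROOT SCHEDULES**
(`rootOblT_of_rootOblS ∘ rootOblS_concSG_sched`): the `RootHolds` head of the D″ closure modulo the binder list of the module docstring.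
[cite: KozmaNitzan2024, §4 p. 28 ((32) at the root), Lemma 11 (pp. 22–23), Lemma 12 (p. 24)] -/
theorem rootOblT_concSG_sched (hlip : Lip G φ) (hstep : Steps G φ) (hfr : Frames G φ types) (hκ : CylConn G φ types) {Δ : ℕ}
    (hΔ : ∀ v, G.degree v ≤ Δ) {p : unitInterval} (hC : CylSubcritical G φ types p) (P : PCells2) (w₀ : V) {Λ : ConcRadiiG}
    (hΛ : WFS2 P Λ) (hφ : φ w₀ = 0) (q : unitInterval) (δc : ℝ) {Δ' : ℕ} {δr : ℕ → ℝ} {Rt L' E₀ : ℕ}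
    (Sc : MDir → Schedule) {Rlev Nc j₀ j₁ : MDir → ℕ} {ca q' : MDir → ℤ}
    (hreg : ∀ du, ∀ k ≤ (Sc du).N, (Sc du).region k ⊆ P.BtwN 0 du ∪ P.Q ((0 : Site 2) + stepVec du))
    (hQ0 : ∀ du, ∀ k ≤ (Sc du).N, Disjoint ((Sc du).region k) (P.Q 0))
    (hlast : ∀ du, (Sc du).core ((Sc du).N + 1) ⊆ P.M ((0 : Site 2) + stepVec du))
    (hrow : ∀ du : MDir, sBox du.1 (sgOf du) (rootCtr du (ca du) 0) (-0) 0 (q' du) ⊆ (Sc du).core 0)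
    (hca25 : ∀ du : MDir, ca du ≤ 25 * (P.r du.1 : ℤ)) (hq'5 : ∀ du : MDir, q' du ≤ 5 * (P.r (oth du.1) : ℤ) - 1)
    (hRl : ∀ du, Rlev du + 1 ≤ (Sc du).R') (hj : ∀ du, j₁ du ≤ Rlev du)
    (hRB : ∀ du, Rt + 1 ≤ Λ.rB 0 0 du) (hRQ : ∀ du, Rt + 1 ≤ Λ.rQ 0 ((0 : Site 2) + stepVec du))
    (hRM : ∀ du, Rt + 1 ≤ Λ.rM 0 ((0 : Site 2) + stepVec du)) (hRt : 60 * P.rmax ≤ Rt) (hQE : Λ.rQ 0 0 ≤ E₀)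
    (hδr0 : ∀ du, 0 < δr (Sc du).N) (hδr1 : ∀ du, δr (Sc du).N ≤ 1)
    (hcount : ∀ du, 1 / (1 - (q : ℝ)) ^ (Δ' * Nc du) ≤ δr (Sc du).N * ((Finset.Icc (j₀ du) (j₁ du)).card : ℝ))
    {D : StepI.Data V} {off : ℕ} (hD : D.Λ = fatSeqOff hfr hC off) {Sz Sx Sy : Finset ℕ} {δI : ℝ}
    (hin : ∀ i ∈ StepI.index types Sz Sx Sy, 1 - δI < (bondPercolation G q).real (StepI.event G φ D i))
    (hδI : ∀ du, δI ≤ δr (Sc du).N ^ 2)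
    {Mz : ℕ} (hMz : Mz ∈ Sz) (hkz : D.k ≤ Mz) {ℓK : Fin 2 → ℕ} (hℓK0 : ∀ I, I = 0 → ℓK I ∈ Sx) (hℓK1 : ∀ I, I = 1 → ℓK I ∈ Sy)
    {A : Fin 2 → Fin 2 → ℕ} {Rk : Fin 2 → ℕ} (hAw : ∀ I, A I = StepI.widths D.Gb D.Fb I (ℓK I)) (hRk : ∀ I, Rk I = D.R (amax (A I)))
    {ℓs M K Rsd r₀ rs cU : ℕ} (hℓs : 1 ≤ ℓs) (hj₀ : ∀ du, tanOff ℓs M ≤ j₀ du)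
    (hA : ∀ i k, A i k ≤ M) (hAℓ : ∀ i, A i (oth i) ≤ ℓs) (hK : ∀ i, ℓs + 1 + A i i + Rk i ≤ K)
    (hnA : ∀ i, Mz + 1 ≤ A i i) (hnM : Mz ≤ M) (hρK : ∀ i, ℓs + 1 + A i i + (fatRadius hfr hC Mz + off) ≤ K)
    (hR'₁ : cylRadMax G φ types ℓs (ℓs + 2 + 2 * tanOff ℓs M) ≤ Rsd) (hR'₂ : ∀ i, cylRadMax G φ types ℓs (ℓs + 2 + A i i + Rk i) ≤ Rsd)
    (hr₀₁ : ℓs + 1 + tanOff ℓs M + Rsd ≤ r₀) (hr₀₂ : ℓs + 2 + tanOff ℓs M + K ≤ r₀) (hr₀L : r₀ ≤ L') (hLR : L' ≤ Rt)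
    (hrs₁ : ℓs + 2 + tanOff ℓs M + Rsd ≤ rs) (hrs₂ : ℓs + 2 + tanOff ℓs M + K ≤ rs) (hcU : ∀ i, (Δ + 1) ^ Rk i ≤ cU)
    (hMℓ : ∀ du, Mz + 1 ≤ (Sc du).ℓ₀)
    (hSx : ∀ du, ∀ k ≤ (Sc du).N, (Sc du).ax k = 0 → ∀ ℓ, (Sc du).ℓ₀ ≤ ℓ → ℓ ≤ (Sc du).ℓ₁ → ℓ ∈ Sx)
    (hSy : ∀ du, ∀ k ≤ (Sc du).N, (Sc du).ax k = 1 → ∀ ℓ, (Sc du).ℓ₀ ≤ ℓ → ℓ ≤ (Sc du).ℓ₁ → ℓ ∈ Sy)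
    (hdepth : ∀ du, ∀ k ≤ (Sc du).N, ∀ I ℓ, (Sc du).ℓ₀ ≤ ℓ → ℓ ≤ (Sc du).ℓ₁ →
      2 * ℓs + 2 + tanOff ℓs M + A I I + D.R (amax (StepI.widths D.Gb D.Fb ((Sc du).ax k) ℓ)) ≤ r₀)
    (hWb : ∀ du, ∀ k ≤ (Sc du).N, ∀ ℓ, (Sc du).ℓ₀ ≤ ℓ → ℓ ≤ (Sc du).ℓ₁ →
      StepI.widths D.Gb D.Fb ((Sc du).ax k) ℓ (oth ((Sc du).ax k)) ≤ (Sc du).Wb k ℓ)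
    (kk : MDir → ℕ) (hN : ∀ du, kk du * (Δ + 1) ^ (2 * rs) ≤ Nc du)
    (hk : ∀ du, (1 - (q : ℝ) ^ (1 + Δ * ((Δ + 1) ^ Rsd + (tanOff ℓs M + 2)) + ((Δ + 1) ^ Rsd + (tanOff ℓs M + 2)) * cU)) ^ kk du ≤
      δr (Sc du).N)
    {mex R₁ : ℕ} {η : ℝ} (hη : ∀ du, η ≤ δr (Sc du).N / 2) (hmex : 60 * P.rmax ≤ mex)
    (hR₁ : ∀ R'', R₁ ≤ R'' → ∀ (Rw : ℕ) (D' A' : Finset V), (∀ d ∈ D', d ∈ graphBall G w₀ Rw) →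
      (∀ d ∈ D', ∀ d' ∈ D', φ d - φ d' ∈ box 2 mex) → A' ⊆ D' → (∀ a ∈ A', a ∈ graphBall G w₀ (E₀ + 1)) →
        (bondPercolation G q).real (excess G w₀ R'' D' A') ≤ η)
    (hR : R₁ ≤ Rt - L')
    {ℓ1 : MDir → ℕ} (hℓ1x : ∀ du : MDir, du.1 = 0 → ℓ1 du ∈ Sx) (hℓ1y : ∀ du : MDir, du.1 = 1 → ℓ1 du ∈ Sy)
    (hℓ1ca : ∀ du, (ℓ1 du : ℤ) ≤ ca du) (hℓ1Q : ∀ du : MDir, (ℓ1 du : ℤ) ≤ 5 * (P.r du.1 : ℤ))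
    (hcaQ : ∀ du : MDir, ca du - ℓ1 du + D.k ≤ 5 * (P.r du.1 : ℤ)) (hkQ : ∀ du : MDir, (D.k : ℤ) ≤ 5 * (P.r (oth du.1) : ℤ))
    (hW₁ : ∀ du : MDir, (StepI.widths D.Gb D.Fb du.1 (ℓ1 du) (oth du.1) : ℤ) ≤ q' du)
    {R₀ Rp : ℕ} (hR₀ : ∀ du : MDir, 5 * P.r du.1 + (fatRadius hfr hC D.k + off) ≤ R₀) (hR₀Q : R₀ + 1 ≤ Λ.rQ 0 0) (hR₀t : R₀ ≤ Rt)
    (hRp : ∀ du : MDir, 5 * P.r du.1 + D.R (amax (StepI.widths D.Gb D.Fb du.1 (ℓ1 du))) ≤ Rp) (hRpQ : Rp + 1 ≤ Λ.rQ 0 0)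
    (hRpB : ∀ du, Rp + 1 ≤ Λ.rB 0 0 du) (hRpQ' : ∀ du, Rp + 1 ≤ Λ.rQ 0 ((0 : Site 2) + stepVec du)) (hRpt : Rp ≤ Rt) :
    RootOblT G (⟨cellGeomSG G φ P w₀ Λ, q, δc⟩ : KSchA V ℕ) Δ' δr :=
  rootOblT_of_rootOblS (rootOblS_concSG_sched hlip hstep hfr hκ hΔ hC P w₀ hΛ hφ q δc Sc hreg hQ0 hlast hrow hca25 hq'5 hRl hj hRB hRQ hRM hRt
    hQE hδr0 hδr1 hcount hD hin hδI hMz hkz hℓK0 hℓK1 hAw hRk hℓs hj₀ hA hAℓ hK hnA hnM hρK hR'₁ hR'₂ hr₀₁ hr₀₂ hr₀L hLR hrs₁ hrs₂ hcU hMℓ hSx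
    hSy hdepth hWb kk hN hk hη hmex hR₁ hR hℓ1x hℓ1y hℓ1ca hℓ1Q hcaQ hkQ hW₁ hR₀ hR₀Q hR₀t hRp hRpQ hRpB hRpQ' hRpt)

end Skelφ

end Transplant

end Summit.CriticalPhenomena.PercolationContinuityZ3.Theorems

end
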